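import Summits.CriticalPhenomena.CardyFormulaZ2.Theorems.CardySelfRefinementCriticalPathRSWStubFiniteSizeCriteriaPrimal

/-!
# Finite-size criteria for `M_k`, part 6: the law of the dual configuration

Support file for item `stmt-CriticalPhenomena-10267` (route `CardySelfRefinement`, crux
`CriticalPathRSW`, line finite-size-envelope, stub `stub_finiteSizeCriteria`): the finite-size
criteria (H. Kesten, *Percolation theory for mathematicians* (1982), Ch. 5, Thm. 5.1; G. Grimmett,
*Percolation* (1999), §11.7) for the `k`-dependent self-refinement laws `M_k(ρ, c)` and their duals.

`dualConfig` commutes with translations and with the transposition of the axes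
(`dualEdge_map_transpose`, `dualConfig_relabel`), so the law `M_k(ρ, c) ∘ dualConfig⁻¹` of the
dual configuration inherits the `kℤ²`-invariance and the transposition invariance of `M_k(ρ, c)`
(`dual_real_preimage_shift`, `dual_real_preimage_transpose`); it is carried by lattice
configurations (`dual_ae_subset_edgeSet`), and events determined by boxes at sup-distance
`> k + 1` are independent under it (`dual_real_inter_eq`: a dual edge is read off the primal edge
it crosses, which lies within distance one).  Planar duality
(`lrCrossing_xor_dualTBCrossing_holds`, Bollobás–Riordan 2006, Ch. 3, Lemma 1) bounds the failure
probability of a horizontal crossing by the dual law of a vertical crossing and conversely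
(`real_compl_hCross_le_dual`, `real_dual_le_compl_hCross`).
-/

noncomputable section

namespace Summit.CriticalPhenomena.CardyFormulaZ2.Cruxes.CriticalPathRSW.FiniteSizeEnvelope

open Set
open Literature.Probability.LatticeModels Literature.Probability.Percolation

namespace FSC

/-! ### Rectangles and crossing events (local notations)

To keep these support files free of new definitions, the four events of the argument are local
notations for explicit instances of the tree's `openCrossing S A B`:

* `rect[a, b, lo, hi]` — the lattice rectangle `[a, b] × [lo, hi] ∩ ℤ²` (a `Finset`, Mathlib's
  order interval of `Site 2 = Fin 2 → ℤ`);
* `hCross[a, b, lo, hi]` — its **horizontal open crossing**: an open path inside the rectangle from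
  the left side `{x₀ = a}` to the right side `{x₀ = b}`;
* `vCross[a, b, lo, hi]` — its **vertical open crossing**, from `{x₁ = lo}` to `{x₁ = hi}`;
* `annulusCross[c, N, R]` — the **annulus event** `A(c; N, R)` of Kesten (1982), Ch. 5: an open
  path inside the box `c + [-R, R]²` from the box `c + [-N, N]²` to the boundary of `c + [-R, R]²`. -/

local notation3 "rect[" a ", " b ", " lo ", " hi "]" =>
  (Finset.Icc ![(a : ℤ), (lo : ℤ)] ![(b : ℤ), (hi : ℤ)] : Finset (Site 2))

local notation3 "hCross[" a ", " b ", " lo ", " hi "]" =>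
  (openCrossing (↑(Finset.Icc ![(a : ℤ), (lo : ℤ)] ![(b : ℤ), (hi : ℤ)] : Finset (Site 2)) : Set (Site 2))
    {x : Site 2 | x ∈ (Finset.Icc ![(a : ℤ), (lo : ℤ)] ![(b : ℤ), (hi : ℤ)] : Finset (Site 2)) ∧ x 0 = (a : ℤ)}
    {x : Site 2 | x ∈ (Finset.Icc ![(a : ℤ), (lo : ℤ)] ![(b : ℤ), (hi : ℤ)] : Finset (Site 2)) ∧ x 0 = (b : ℤ)} :
    Set (BondConfig (Site 2)))

local notation3 "vCross[" a ", " b ", " lo ", " hi "]" =>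
  (openCrossing (↑(Finset.Icc ![(a : ℤ), (lo : ℤ)] ![(b : ℤ), (hi : ℤ)] : Finset (Site 2)) : Set (Site 2))
    {x : Site 2 | x ∈ (Finset.Icc ![(a : ℤ), (lo : ℤ)] ![(b : ℤ), (hi : ℤ)] : Finset (Site 2)) ∧ x 1 = (lo : ℤ)}
    {x : Site 2 | x ∈ (Finset.Icc ![(a : ℤ), (lo : ℤ)] ![(b : ℤ), (hi : ℤ)] : Finset (Site 2)) ∧ x 1 = (hi : ℤ)} :
    Set (BondConfig (Site 2)))

local notation3 "annulusCross[" c ", " N ", " R "]" =>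
  (openCrossing
    (↑(Finset.Icc ![(c : Site 2) 0 - ((R : ℕ) : ℤ), (c : Site 2) 1 - ((R : ℕ) : ℤ)]
        ![(c : Site 2) 0 + ((R : ℕ) : ℤ), (c : Site 2) 1 + ((R : ℕ) : ℤ)] : Finset (Site 2)) : Set (Site 2))
    (↑(Finset.Icc ![(c : Site 2) 0 - ((N : ℕ) : ℤ), (c : Site 2) 1 - ((N : ℕ) : ℤ)]
        ![(c : Site 2) 0 + ((N : ℕ) : ℤ), (c : Site 2) 1 + ((N : ℕ) : ℤ)] : Finset (Site 2)) : Set (Site 2))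
    {x : Site 2 | x ∈ (Finset.Icc ![(c : Site 2) 0 - ((R : ℕ) : ℤ), (c : Site 2) 1 - ((R : ℕ) : ℤ)]
        ![(c : Site 2) 0 + ((R : ℕ) : ℤ), (c : Site 2) 1 + ((R : ℕ) : ℤ)] : Finset (Site 2)) ∧
      (x 0 = (c : Site 2) 0 - ((R : ℕ) : ℤ) ∨ x 0 = (c : Site 2) 0 + ((R : ℕ) : ℤ) ∨
        x 1 = (c : Site 2) 1 - ((R : ℕ) : ℤ) ∨ x 1 = (c : Site 2) 1 + ((R : ℕ) : ℤ))} :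
    Set (BondConfig (Site 2)))


/-! ## The law of the dual configuration

`dualConfig` commutes with translations and with the transposition of the axes, so the law
`M_k(ρ, c) ∘ dualConfig⁻¹` of the dual configuration inherits the `kℤ²`-invariance and the
transposition invariance of `M_k(ρ, c)`; it is carried by lattice configurations, and events
determined by boxes at sup-distance `> k + 1` are independent under it (a dual edge is read off the
primal edge it crosses, which lies within distance one).  Planar duality
(`lrCrossing_xor_dualTBCrossing_holds`) bounds the failure probability of a horizontal crossing by
the probability of a vertical dual crossing. -/

section Dual

open MeasureTheory

/-- `dualEdge` commutes with the transposition of the axes. -/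
theorem dualEdge_map_transpose (e : Sym2 (Site 2)) :
    dualEdge (Sym2.map transposeIso e) = Sym2.map transposeIso (dualEdge e) := by
  have transposeIso_single : ∀ i : Fin 2,
      (transposeIso (Pi.single i 1 : Site 2) : Site 2) = Pi.single (Equiv.swap (0 : Fin 2) 1 i) 1 := by
    intro i; ext j; fin_cases i <;> fin_cases j <;> simp
  have transposeIso_add : ∀ x y : Site 2,
      (transposeIso (x + y) : Site 2) = transposeIso x + transposeIso y := by
    intro x y; ext j; fin_cases j <;> simp
  have transposeIso_sub : ∀ x y : Site 2,
      (transposeIso (x - y) : Site 2) = transposeIso x - transposeIso y := by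
    intro x y; ext j; fin_cases j <;> simp
  by_cases he : e ∈ (zdGraph 2).edgeSet
  · obtain ⟨u, i, rfl⟩ := mem_edgeSet_zdGraph_iff.1 he
    rw [Sym2.map_mk, transposeIso_add, transposeIso_single]
    fin_cases i
    · simp only [Fin.zero_eta, Fin.isValue, Equiv.swap_apply_left]
      rw [dualEdge_horizontal, dualEdge_vertical, Sym2.map_mk, transposeIso_sub,
        transposeIso_single]
      simp
    · simp only [Fin.mk_one, Fin.isValue, Equiv.swap_apply_right]
      rw [dualEdge_horizontal, dualEdge_vertical, Sym2.map_mk, transposeIso_sub,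
        transposeIso_single]
      simp
  · have he' : Sym2.map transposeIso e ∉ (zdGraph 2).edgeSet := fun h =>
      he ((sym2Equiv_mem_edgeSet_iff transposeIso e).1 h)
    rw [dualEdge_of_not_mem he, dualEdge_of_not_mem he']

/-- **Duality commutes with a lattice symmetry** `ψ` whose action on pairs commutes with
`dualEdge` and preserves the edge set. -/
theorem dualConfig_relabel (ψ : Site 2 ≃ Site 2)
    (hψ : ∀ e, dualEdge (Sym2.map ψ e) = Sym2.map ψ (dualEdge e))
    (hE : ∀ e, Sym2.map ψ e ∈ (zdGraph 2).edgeSet ↔ e ∈ (zdGraph 2).edgeSet)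
    (ω : BondConfig (Site 2)) :
    dualConfig (BondConfig.relabel (sym2Equiv ψ) ω) =
      BondConfig.relabel (sym2Equiv ψ) (dualConfig ω) := by
  ext e
  rw [BondConfig.mem_relabel_iff, mem_dualConfig_iff, mem_dualConfig_iff]
  have hsymm : (sym2Equiv ψ).symm e ∈ (zdGraph 2).edgeSet ↔ e ∈ (zdGraph 2).edgeSet := by
    have h1 := hE ((sym2Equiv ψ).symm e)
    rw [← sym2Equiv_apply, Equiv.apply_symm_apply] at h1
    exact h1.symm
  rw [hsymm]
  refine and_congr_right fun _ => ⟨fun h e' he' heq => ?_, fun h e' he' heq => ?_⟩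
  · refine h (sym2Equiv ψ e') ?_ ?_
    · rwa [BondConfig.mem_relabel_iff, Equiv.symm_apply_apply]
    · rw [sym2Equiv_apply, hψ, heq, ← sym2Equiv_apply, Equiv.apply_symm_apply]
  · rw [BondConfig.mem_relabel_iff] at he'
    refine h _ he' ?_
    apply (sym2Equiv ψ).injective
    rw [Equiv.apply_symm_apply, sym2Equiv_apply, ← hψ, ← sym2Equiv_apply, Equiv.apply_symm_apply,
      heq]

/-- **Symmetries of the dual law**: if `μ` is invariant under a lattice symmetry commuting with
`dualEdge`, so is the law `μ ∘ dualConfig⁻¹` of the dual configuration. -/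
theorem map_dualConfig_map_relabel (μ : Measure (BondConfig (Site 2))) (ψ : Site 2 ≃ Site 2)
    (hψ : ∀ e, dualEdge (Sym2.map ψ e) = Sym2.map ψ (dualEdge e))
    (hE : ∀ e, Sym2.map ψ e ∈ (zdGraph 2).edgeSet ↔ e ∈ (zdGraph 2).edgeSet)
    (hμ : μ.map (BondConfig.relabel (sym2Equiv ψ)) = μ) :
    (μ.map dualConfig).map (BondConfig.relabel (sym2Equiv ψ)) = μ.map dualConfig := by
  rw [Measure.map_map (MeasurableEquiv.measurable _) measurable_dualConfig,
    show (BondConfig.relabel (sym2Equiv ψ)) ∘ dualConfig =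
      dualConfig ∘ (BondConfig.relabel (sym2Equiv ψ)) from
        funext fun ω => (dualConfig_relabel ψ hψ hE ω).symm,
    ← Measure.map_map measurable_dualConfig (MeasurableEquiv.measurable _), hμ]

/-- Applied form: the dual law gives the same probability to an event and to its preimage under a
lattice symmetry commuting with `dualEdge` that preserves `μ`. -/
theorem map_dualConfig_real_preimage_relabel (μ : Measure (BondConfig (Site 2)))
    (ψ : Site 2 ≃ Site 2) (hψ : ∀ e, dualEdge (Sym2.map ψ e) = Sym2.map ψ (dualEdge e))
    (hE : ∀ e, Sym2.map ψ e ∈ (zdGraph 2).edgeSet ↔ e ∈ (zdGraph 2).edgeSet)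
    (hμ : μ.map (BondConfig.relabel (sym2Equiv ψ)) = μ) (A : Set (BondConfig (Site 2))) :
    (μ.map dualConfig).real (BondConfig.relabel (sym2Equiv ψ) ⁻¹' A) = (μ.map dualConfig).real A := by
  rw [measureReal_def, measureReal_def, ← MeasurableEquiv.map_apply,
    map_dualConfig_map_relabel μ ψ hψ hE hμ]

/-- The dual law of `M_k(ρ, c)` is invariant under the translations of `kℤ²`. -/
theorem dual_real_preimage_shift {k : ℕ} (hk : k ≠ 0) (ρ c : ℝ) (a : Site 2)
    (A : Set (BondConfig (Site 2))) :
    ((selfRefinementMeasure k ρ c).map dualConfig).real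
        (BondConfig.relabel (sym2Equiv (Site.shift ((k : ℤ) • a))) ⁻¹' A) =
      ((selfRefinementMeasure k ρ c).map dualConfig).real A := by
  -- `dualEdge` commutes with translations
  have hcomm : ∀ (v : Site 2) (e : Sym2 (Site 2)),
      dualEdge (Sym2.map (Site.shift v) e) = Sym2.map (Site.shift v) (dualEdge e) := by
    intro v e
    by_cases he : e ∈ (zdGraph 2).edgeSet
    · obtain ⟨u, i, rfl⟩ := mem_edgeSet_zdGraph_iff.1 he
      have h1 : Sym2.map (Site.shift v) s(u, u + Pi.single i 1) =
          s(u + v, (u + v) + Pi.single i 1) := by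
        rw [Sym2.map_mk, Site.shift_apply, Site.shift_apply, add_right_comm]
      rw [h1]
      fin_cases i
      · simp only [Fin.zero_eta, Fin.isValue]
        rw [dualEdge_horizontal, dualEdge_horizontal, Sym2.map_mk, Site.shift_apply,
          Site.shift_apply, add_sub_right_comm]
      · simp only [Fin.mk_one, Fin.isValue]
        rw [dualEdge_vertical, dualEdge_vertical, Sym2.map_mk, Site.shift_apply,
          Site.shift_apply, add_sub_right_comm]
    · have he' : Sym2.map (Site.shift v) e ∉ (zdGraph 2).edgeSet := fun h =>
        he ((sym2Equiv_mem_edgeSet_iff (zdShiftIso v) e).1 h)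
      rw [dualEdge_of_not_mem he, dualEdge_of_not_mem he']
  exact map_dualConfig_real_preimage_relabel _ (Site.shift ((k : ℤ) • a)) (hcomm _)
    (fun e => sym2Equiv_mem_edgeSet_iff (zdShiftIso ((k : ℤ) • a)) e)
    (selfRefinementMeasure_map_relabel_shift hk ρ c a) A

/-- The dual law of `M_k(ρ, c)` is invariant under the transposition of the axes. -/
theorem dual_real_preimage_transpose (k : ℕ) (ρ c : ℝ) (A : Set (BondConfig (Site 2))) :
    ((selfRefinementMeasure k ρ c).map dualConfig).real
        (BondConfig.relabel (sym2Equiv (transposeIso.toEquiv : Site 2 ≃ Site 2)) ⁻¹' A) =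
      ((selfRefinementMeasure k ρ c).map dualConfig).real A :=
  map_dualConfig_real_preimage_relabel _ transposeIso.toEquiv (fun e => dualEdge_map_transpose e)
    (fun e => sym2Equiv_mem_edgeSet_iff transposeIso e)
    (selfRefinementMeasure_map_relabel_transpose k ρ c) A

/-- The dual law is a probability measure. -/
theorem isProbabilityMeasure_dual (k : ℕ) (ρ c : ℝ) :
    IsProbabilityMeasure ((selfRefinementMeasure k ρ c).map dualConfig) :=
  Measure.isProbabilityMeasure_map measurable_dualConfig.aemeasurable

/-- The dual configuration is always a lattice configuration, so the dual law is carried by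
lattice configurations. -/
theorem dual_ae_subset_edgeSet (k : ℕ) (ρ c : ℝ) :
    ∀ᵐ ω ∂((selfRefinementMeasure k ρ c).map dualConfig), ω ⊆ (zdGraph 2).edgeSet := by
  -- `{ω | ω ⊆ E(ℤ²)}` is measurable (a countable intersection of coordinate events)
  have hmeas : MeasurableSet {ω : BondConfig (Site 2) | ω ⊆ (zdGraph 2).edgeSet} := by
    have h : {ω : BondConfig (Site 2) | ω ⊆ (zdGraph 2).edgeSet} =
        ⋂ e ∈ ((zdGraph 2).edgeSet)ᶜ, {ω | e ∉ ω} := by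
      ext ω
      simp only [Set.mem_setOf_eq, Set.mem_iInter, Set.mem_compl_iff]
      exact ⟨fun h e he heω => he (h heω), fun h e heω => by_contra fun he => h e he heω⟩
    rw [h]
    exact MeasurableSet.biInter (Set.to_countable _) fun e _ => (measurableSet_mem e).compl
  rw [ae_map_iff measurable_dualConfig.aemeasurable hmeas]
  exact Filter.Eventually.of_forall fun ω e he => he.1

/-- The primal edges whose dual edges join two vertices of `U` have both endpoints in the
thickening `U ∪ (U + e₀) ∪ (U + e₁)`. -/
theorem dualEdge_preimage_sym2_subset (U : Finset (Site 2)) [DecidableEq (Site 2)] :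
    dualEdge ⁻¹' (↑U.sym2 : Set (Sym2 (Site 2))) ⊆
      ↑(U ∪ U.image (· + Pi.single 0 1) ∪ U.image (· + Pi.single 1 1)).sym2 := by
  intro e he
  rw [Set.mem_preimage, Finset.mem_coe, Finset.mem_sym2_iff] at he
  rw [Finset.mem_coe, Finset.mem_sym2_iff]
  by_cases hE : e ∈ (zdGraph 2).edgeSet
  · obtain ⟨u, i, rfl⟩ := mem_edgeSet_zdGraph_iff.1 hE
    fin_cases i
    · simp only [Fin.zero_eta, Fin.isValue] at he ⊢
      rw [dualEdge_horizontal] at he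
      have hu : u ∈ U := he u (by simp)
      intro a ha
      rcases Sym2.mem_iff.1 ha with rfl | rfl
      · simp [hu]
      · simp only [Finset.mem_union, Finset.mem_image]
        exact Or.inl (Or.inr ⟨_, hu, rfl⟩)
    · simp only [Fin.mk_one, Fin.isValue] at he ⊢
      rw [dualEdge_vertical] at he
      have hu : u ∈ U := he u (by simp)
      intro a ha
      rcases Sym2.mem_iff.1 ha with rfl | rfl
      · simp [hu]
      · simp only [Finset.mem_union, Finset.mem_image]
        exact Or.inr ⟨_, hu, rfl⟩
  · rw [dualEdge_of_not_mem hE] at he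
    intro a ha
    simp [he a ha]

/-- Sup-distance `> k + 1` between `u₀, v₀` leaves sup-distance `> k` after moving each by a
lattice unit vector or not at all. -/
theorem sep_thicken {k : ℕ} {u₀ v₀ u v : Site 2}
    (h : ((k + 1 : ℕ) : ℤ) < |u₀ 0 - v₀ 0| ∨ ((k + 1 : ℕ) : ℤ) < |u₀ 1 - v₀ 1|)
    (hu : u = u₀ ∨ u = u₀ + Pi.single 0 1 ∨ u = u₀ + Pi.single 1 1)
    (hv : v = v₀ ∨ v = v₀ + Pi.single 0 1 ∨ v = v₀ + Pi.single 1 1) :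
    (k : ℤ) < |u 0 - v 0| ∨ (k : ℤ) < |u 1 - v 1| := by
  have hu' : (u 0 = u₀ 0 ∨ u 0 = u₀ 0 + 1) ∧ (u 1 = u₀ 1 ∨ u 1 = u₀ 1 + 1) := by
    rcases hu with rfl | rfl | rfl <;> simp
  have hv' : (v 0 = v₀ 0 ∨ v 0 = v₀ 0 + 1) ∧ (v 1 = v₀ 1 ∨ v 1 = v₀ 1 + 1) := by
    rcases hv with rfl | rfl | rfl <;> simp
  push_cast at h
  rw [lt_abs, lt_abs] at h ⊢
  omega

/-- **Finite-range independence of the dual law**: under `M_k(ρ, c) ∘ dualConfig⁻¹`, events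
determined by the pairs of vertices of two finite sets at sup-distance `> k + 1` are independent
(`k > 0`). -/
theorem dual_real_inter_eq {k : ℕ} (hk : 0 < k) (ρ c : ℝ) (U V : Finset (Site 2))
    (hsep : ∀ u ∈ U, ∀ v ∈ V, ((k + 1 : ℕ) : ℤ) < |u 0 - v 0| ∨ ((k + 1 : ℕ) : ℤ) < |u 1 - v 1|)
    (A B : Set (BondConfig (Site 2))) (hA : DeterminedBy A ↑U.sym2) (hB : DeterminedBy B ↑V.sym2)
    (hAm : MeasurableSet A) (hBm : MeasurableSet B) :
    ((selfRefinementMeasure k ρ c).map dualConfig).real (A ∩ B) =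
      ((selfRefinementMeasure k ρ c).map dualConfig).real A *
        ((selfRefinementMeasure k ρ c).map dualConfig).real B := by
  classical
  -- events determined by `F` pull back under `dualConfig` to events determined by `dualEdge ⁻¹' F`
  have hdet : ∀ {C : Set (BondConfig (Site 2))} {F : Set (Sym2 (Site 2))},
      DeterminedBy C F → DeterminedBy (dualConfig ⁻¹' C) (dualEdge ⁻¹' F) := by
    intro C F h
    rw [determinedBy_iff] at h ⊢
    intro ω ω' hωF
    simp only [Set.mem_preimage]
    refine h _ _ ?_
    ext e
    simp only [Set.mem_inter_iff, mem_dualConfig_iff]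
    constructor
    · rintro ⟨⟨he, hne⟩, heF⟩
      refine ⟨⟨he, fun e' he' heq => ?_⟩, heF⟩
      have h3 : e' ∈ ω' ∩ dualEdge ⁻¹' F := ⟨he', by rw [Set.mem_preimage, heq]; exact heF⟩
      rw [← hωF] at h3
      exact hne e' h3.1 heq
    · rintro ⟨⟨he, hne⟩, heF⟩
      refine ⟨⟨he, fun e' he' heq => ?_⟩, heF⟩
      have h3 : e' ∈ ω ∩ dualEdge ⁻¹' F := ⟨he', by rw [Set.mem_preimage, heq]; exact heF⟩
      rw [hωF] at h3
      exact hne e' h3.1 heq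
  rw [map_measureReal_apply measurable_dualConfig (hAm.inter hBm),
    map_measureReal_apply measurable_dualConfig hAm, map_measureReal_apply measurable_dualConfig hBm,
    Set.preimage_inter]
  refine selfRefinementMeasure_real_inter_eq hk ρ c
    (U ∪ U.image (· + Pi.single 0 1) ∪ U.image (· + Pi.single 1 1))
    (V ∪ V.image (· + Pi.single 0 1) ∪ V.image (· + Pi.single 1 1)) ?_ _ _
    ((hdet hA).mono (dualEdge_preimage_sym2_subset U))
    ((hdet hB).mono (dualEdge_preimage_sym2_subset V))
    (measurable_dualConfig hAm) (measurable_dualConfig hBm)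
  intro u hu v hv
  simp only [Finset.mem_union, Finset.mem_image] at hu hv
  rcases hu with (hu | ⟨u₀, hu₀, rfl⟩) | ⟨u₀, hu₀, rfl⟩ <;>
    rcases hv with (hv | ⟨v₀, hv₀, rfl⟩) | ⟨v₀, hv₀, rfl⟩
  · exact sep_thicken (hsep u hu v hv) (Or.inl rfl) (Or.inl rfl)
  · exact sep_thicken (hsep u hu v₀ hv₀) (Or.inl rfl) (Or.inr (Or.inl rfl))
  · exact sep_thicken (hsep u hu v₀ hv₀) (Or.inl rfl) (Or.inr (Or.inr rfl))
  · exact sep_thicken (hsep u₀ hu₀ v hv) (Or.inr (Or.inl rfl)) (Or.inl rfl)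
  · exact sep_thicken (hsep u₀ hu₀ v₀ hv₀) (Or.inr (Or.inl rfl)) (Or.inr (Or.inl rfl))
  · exact sep_thicken (hsep u₀ hu₀ v₀ hv₀) (Or.inr (Or.inl rfl)) (Or.inr (Or.inr rfl))
  · exact sep_thicken (hsep u₀ hu₀ v hv) (Or.inr (Or.inr rfl)) (Or.inl rfl)
  · exact sep_thicken (hsep u₀ hu₀ v₀ hv₀) (Or.inr (Or.inr rfl)) (Or.inr (Or.inl rfl))
  · exact sep_thicken (hsep u₀ hu₀ v₀ hv₀) (Or.inr (Or.inr rfl)) (Or.inr (Or.inr rfl))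

/-- **Planar duality bound**: under `M_k(ρ, c)`, the failure of the horizontal crossing of
`[0, M] × [0, N]` has probability at most that of the vertical crossing of `[0, M - 1] × [-1, N]`
under the dual law ("no open left-right crossing ⟹ a dual-open top-bottom crossing",
`lrCrossing_xor_dualTBCrossing_holds`). -/
theorem real_compl_hCross_le_dual (k : ℕ) (ρ c : ℝ) (M N : ℕ) :
    (selfRefinementMeasure k ρ c).real (hCross[0, M, 0, N])ᶜ ≤
      ((selfRefinementMeasure k ρ c).map dualConfig).real (vCross[0, ((M : ℤ) - 1), (-1), N]) := by
  rw [map_measureReal_apply measurable_dualConfig (measurableSet_vCross _ _ _ _), ← dualTBCrossing_eq,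
    measureReal_def, measureReal_def]
  refine ENNReal.toReal_mono (measure_ne_top _ _) (measure_mono_ae
    ((selfRefinementMeasure_ae_subset_edgeSet k ρ c).mono fun ω hω h => ?_))
  have hx := lrCrossing_xor_dualTBCrossing_holds M N hω
  rw [lrCrossing_eq_hCross] at hx
  exact hx.or.resolve_left h

/-- **Planar duality bound, exclusive direction**: a vertical dual crossing of `[0, M - 1] × [-1, N]`
excludes the horizontal crossing of `[0, M] × [0, N]`, so its probability under the dual law is at
most the failure probability of the latter. -/
theorem real_dual_le_compl_hCross (k : ℕ) (ρ c : ℝ) (M N : ℕ) :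
    ((selfRefinementMeasure k ρ c).map dualConfig).real (vCross[0, ((M : ℤ) - 1), (-1), N]) ≤
      (selfRefinementMeasure k ρ c).real (hCross[0, M, 0, N])ᶜ := by
  rw [map_measureReal_apply measurable_dualConfig (measurableSet_vCross _ _ _ _), ← dualTBCrossing_eq,
    measureReal_def, measureReal_def]
  refine ENNReal.toReal_mono (measure_ne_top _ _) (measure_mono_ae
    ((selfRefinementMeasure_ae_subset_edgeSet k ρ c).mono fun ω hω h => ?_))
  have hx := lrCrossing_xor_dualTBCrossing_holds M N hω
  rw [lrCrossing_eq_hCross] at hx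
  rcases hx with ⟨-, h2⟩ | ⟨-, h2⟩
  · exact absurd h h2
  · exact h2

/-- **Headline of this support file** (registered sub-stub `stub_finiteSizeCriteria_dual` of
`stub_finiteSizeCriteria`): the finite-range independence of the dual law `M_k(ρ, c) ∘ dualConfig⁻¹` (`dual_real_inter_eq`). -/
theorem stub_finiteSizeCriteria_dual :
    ∀ (k : ℕ), 0 < k → ∀ (ρ c : ℝ) (U V : Finset (Site 2)), (∀ u ∈ U, ∀ v ∈ V, ((k + 1 : ℕ) : ℤ) < |u 0 - v 0| ∨ ((k + 1 : ℕ) : ℤ) < |u 1 - v 1|) → ∀ (A B : Set (BondConfig (Site 2))), DeterminedBy A ↑U.sym2 → DeterminedBy B ↑V.sym2 → MeasurableSet A → MeasurableSet B → ((selfRefinementMeasure k ρ c).map dualConfig).real (A ∩ B) = ((selfRefinementMeasure k ρ c).map dualConfig).real A * ((selfRefinementMeasure k ρ c).map dualConfig).real B :=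
  fun _ hk ρ c U V hsep A B hA hB hAm hBm => dual_real_inter_eq hk ρ c U V hsep A B hA hB hAm hBm

end Dual

end FSC

end Summit.CriticalPhenomena.CardyFormulaZ2.Cruxes.CriticalPathRSW.FiniteSizeEnvelope
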